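import Summits.ResolutionOfSingularities.ResolutionOfSingularities.Theorems.EquisingularLiftEquisingularLiftNatDOddTower
import HarnessLib

/-!
# [OURS] `E₆ = y₀³ + y₁⁴ + y₂²` HAS BLOW-UP DEPTH `3` IN EVERY BLOW-UP TOWER (`2 ≠ 0` in `K`), through `A₅ = y₀³y₁ + y₁² + y₂²` (depth `2`) and
# `A₃ = y₀²y₁ + y₁² + y₂²` (depth `1`, ✓ `towerLevel_origin_A₃'`) — exact trinomial arithmetic, `E₆ → A₅ → A₃ → A₁` LITERALLY along the charts
# (cruxes `Theses.EquisingularLift.EquisingularLiftNat` / `…NatThree` / `EquisingularLift`, stmt-ResolutionOfSingularities-20038 / -20148 / -15660)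

[OURS · leafhand-res-equisingularlift-12 g1, 2026-09-01; cell `pub/decomp-res`] AI-produced, weaker than expert review; NOT a statement of any manuscript;
nothing here proves resolution of singularities in positive characteristic.  DEF-FREE helper; no `sorry`; standard axioms; ZERO named hypotheses.

With `x := y₂`, `y := y₀`, `z := y₁`: `E₆ = x² + y³ + z⁴`; chart `1` (`y₀ ↦ T₁T₀`, `y₂ ↦ T₁T₂`) carries `T₀³T₁ + T₁² + T₂²` (an `A₅` point with tangent cone
`T₁² + T₂²`, here called `A₅''`) at its origin, chart `0` is a graph, chart `2` is empty; chart `0` of `A₅''` carries `T₀²T₁ + T₁² + T₂² = A₃'` LITERALLY,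
charts `1`, `2` of `A₅''` are regular along the exceptional divisor when `2 ≠ 0` (in characteristic `2` the cone `T₁² + T₂²` is a double plane and these
trinomials are not the right normal forms).

* `SecondOrderPoint.A₅''_strictTransform₀/₁/₂`, `A₅''_jac₀`, `A₅''_chart₁_regular`, `A₅''_chart₂_regular`, `E₆_strictTransform₀/₁`, `E₆_tail_mem_pow`;
* ★★ `OneStep.towerLevel_origin_A₅''` — `y₀³y₁ + y₁² + y₂²` has `D`-level `2` (`2 ≠ 0`);
* ★★★ `OneStep.towerLevel_origin_E₆` — `y₀³ + y₁⁴ + y₂²` has `D`-level `3` (`2 ≠ 0`).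

With ✓ `…NatAOddTower` / `…NatAEvenTower` (leafhand-12 g0: `A_n`), ✓ `…NatDEvenTower` / `…NatDOddTower` (`D_n`), ✓ `…NatESeriesTower` (`E₇`, `E₈`) this
completes the depth table of the simple (ADE) normal forms in the route's tower currency: `A_{2k+1}, A_{2k+2} ↦ k`, `D_{2m+4}, D_{2m+5} ↦ m + 1, m + 2`,
`E₆ ↦ 3`, `E₇ ↦ 3`, `E₈ ↦ 4` — the classical «absolutely isolated double points» statement, normal form by normal form.
Honest label: local level statements only (no vertex corollaries); closes no registered stub.

References: [Hartshorne1977, I Thm. 5.1, I Ex. 5.6, II Ex. 7.12]; [Lipman1969, §24]; [Artin1977, §3]; [StacksProject, Tags 0804, 080E]; through the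
cited tree files.
-/

set_option linter.dupNamespace false -- mandated namespace `Summit.<Summit>.<Problem>` of this single-conjunct summit

noncomputable section

open CategoryTheory CategoryTheory.Limits AlgebraicGeometry TopologicalSpace Topology
open MvPolynomial
open Literature.AlgebraicGeometry.Resolution
open AlgebraicGeometry.Scheme.IdealSheafData

namespace Summit.ResolutionOfSingularities.ResolutionOfSingularities.Cruxes.EquisingularLiftNat.Sections

namespace SecondOrderPoint

variable (K : Type) [Field K]

/-! ## `A₅'' = (y₁² + y₂²) + y₀³y₁`: charts -/

/-- **Chart `0` of `A₅''`**: `T₀²·(T₀²T₁ + T₁² + T₂²)` — the `A₃'` normal form LITERALLY. [cite: Hartshorne1977, II Ex. 7.12] -/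
theorem A₅''_strictTransform₀ :
    aeval (fun j => X 0 * Function.update (X : Fin 3 → MvPolynomial (Fin 3) K) 0 1 j)
        ((X 1 ^ 2 + X 2 ^ 2) + X 0 ^ 3 * X 1 : MvPolynomial (Fin 3) K) = X 0 ^ 2 * (X 0 ^ 2 * X 1 + X 1 ^ 2 + X 2 ^ 2) := by
  simp only [map_add, map_mul, map_pow, aeval_X, Function.update_self, Function.update_of_ne (by decide : (1 : Fin 3) ≠ 0),
    Function.update_of_ne (by decide : (2 : Fin 3) ≠ 0)]
  ring

/-- **Chart `1` of `A₅''`**: `T₁²·(1 + T₂T₂ + T₀³T₁²)`. [cite: Hartshorne1977, II Ex. 7.12] -/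
theorem A₅''_strictTransform₁ :
    aeval (fun j => X 1 * Function.update (X : Fin 3 → MvPolynomial (Fin 3) K) 1 1 j)
        ((X 1 ^ 2 + X 2 ^ 2) + X 0 ^ 3 * X 1 : MvPolynomial (Fin 3) K) = X 1 ^ 2 * (1 + X 2 * X 2 + X 0 ^ 3 * X 1 ^ 2) := by
  simp only [map_add, map_mul, map_pow, aeval_X, Function.update_self, Function.update_of_ne (by decide : (0 : Fin 3) ≠ 1),
    Function.update_of_ne (by decide : (2 : Fin 3) ≠ 1)]
  ring

/-- **Chart `2` of `A₅''`**: `T₂²·(1 + T₁T₁ + T₀³T₁T₂²)`. [cite: Hartshorne1977, II Ex. 7.12] -/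
theorem A₅''_strictTransform₂ :
    aeval (fun j => X 2 * Function.update (X : Fin 3 → MvPolynomial (Fin 3) K) 2 1 j)
        ((X 1 ^ 2 + X 2 ^ 2) + X 0 ^ 3 * X 1 : MvPolynomial (Fin 3) K) = X 2 ^ 2 * (1 + X 1 * X 1 + X 0 ^ 3 * X 1 * X 2 ^ 2) := by
  simp only [map_add, map_mul, map_pow, aeval_X, Function.update_self, Function.update_of_ne (by decide : (0 : Fin 3) ≠ 2),
    Function.update_of_ne (by decide : (1 : Fin 3) ≠ 2)]
  ring

/-- **Chart `0` of `A₅''`, mark analysis** (`2 ≠ 0`): a prime containing `T₀`, `G₀ = T₀²T₁ + T₁² + T₂²` and `∂₁G₀ = T₀² + 2T₁` contains all `T_i`.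
[cite: Hartshorne1977, I Thm. 5.1] -/
theorem A₅''_jac₀ (h2 : (2 : K) ≠ 0) (P : Ideal (MvPolynomial (Fin 3) K)) (hP : P.IsPrime) (h0 : (X 0 : MvPolynomial (Fin 3) K) ∈ P)
    (hG : (X 0 ^ 2 * X 1 + X 1 ^ 2 + X 2 ^ 2 : MvPolynomial (Fin 3) K) ∈ P)
    (hd : ∀ j, pderiv j (X 0 ^ 2 * X 1 + X 1 ^ 2 + X 2 ^ 2 : MvPolynomial (Fin 3) K) ∈ P) (i : Fin 3) :
    (X i - C ((0 : Fin 3 → K) i) : MvPolynomial (Fin 3) K) ∈ P := by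
  have hX1 : (X 1 : MvPolynomial (Fin 3) K) ∈ P := by
    have h := hd 1
    rw [map_add, map_add, pderiv_mul, pderiv_pow, pderiv_pow, pderiv_pow, pderiv_X_of_ne (by decide : (0 : Fin 3) ≠ 1), pderiv_X_self,
      pderiv_X_of_ne (by decide : (2 : Fin 3) ≠ 1)] at h
    refine mem_of_C_mul_mem K h2 P hP ?_
    rw [C_two_mul]
    have e : (X 1 + X 1 : MvPolynomial (Fin 3) K) =
        (↑2 * X 0 ^ (2 - 1) * 0 * X 1 + X 0 ^ 2 * 1 + ↑2 * X 1 ^ (2 - 1) * 1 + ↑2 * X 2 ^ (2 - 1) * 0) - X 0 * X 0 := by ring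
    rw [e]; exact P.sub_mem h (P.mul_mem_left _ h0)
  have hX2 : (X 2 : MvPolynomial (Fin 3) K) ∈ P := by
    refine hP.mem_of_pow_mem 2 ?_
    have e : (X 2 ^ 2 : MvPolynomial (Fin 3) K) = (X 0 ^ 2 * X 1 + X 1 ^ 2 + X 2 ^ 2) - (X 0 ^ 2 + X 1) * X 1 := by ring
    rw [e]; exact P.sub_mem hG (P.mul_mem_left _ hX1)
  exact forall_X_sub_C_zero_mem K P h0 hX1 hX2 i

/-- **Chart `1` of `A₅''` is regular along `T₁ = 0`** (`2 ≠ 0`). [cite: Hartshorne1977, I Thm. 5.1] -/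
theorem A₅''_chart₁_regular (h2 : (2 : K) ≠ 0) (P : Ideal (MvPolynomial (Fin 3) K)) (hP : P.IsPrime) (h1 : (X 1 : MvPolynomial (Fin 3) K) ∈ P)
    (hG : (1 + X 2 * X 2 + X 0 ^ 3 * X 1 ^ 2 : MvPolynomial (Fin 3) K) ∈ P) :
    pderiv 2 (1 + X 2 * X 2 + X 0 ^ 3 * X 1 ^ 2 : MvPolynomial (Fin 3) K) ∉ P := by
  intro hd
  rw [map_add, map_add, pderiv_one, pderiv_mul, pderiv_X_self, pderiv_mul, pderiv_pow, pderiv_pow,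
    pderiv_X_of_ne (by decide : (0 : Fin 3) ≠ 2), pderiv_X_of_ne (by decide : (1 : Fin 3) ≠ 2)] at hd
  have hX2 : (X 2 : MvPolynomial (Fin 3) K) ∈ P := by
    refine mem_of_C_mul_mem K h2 P hP ?_
    rw [C_two_mul]
    have e : (X 2 + X 2 : MvPolynomial (Fin 3) K) =
        0 + (1 * X 2 + X 2 * 1) + (↑3 * X 0 ^ (3 - 1) * 0 * X 1 ^ 2 + X 0 ^ 3 * (↑2 * X 1 ^ (2 - 1) * 0)) := by ring
    rw [e]; exact hd
  have e : (1 : MvPolynomial (Fin 3) K) = (1 + X 2 * X 2 + X 0 ^ 3 * X 1 ^ 2) - (X 2 * X 2 + (X 0 ^ 3 * X 1) * X 1) := by ring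
  exact hP.ne_top ((Ideal.eq_top_iff_one P).mpr (e ▸ P.sub_mem hG (P.add_mem (P.mul_mem_left _ hX2) (P.mul_mem_left _ h1))))

/-- **Chart `2` of `A₅''` is regular along `T₂ = 0`** (`2 ≠ 0`). [cite: Hartshorne1977, I Thm. 5.1] -/
theorem A₅''_chart₂_regular (h2 : (2 : K) ≠ 0) (P : Ideal (MvPolynomial (Fin 3) K)) (hP : P.IsPrime) (hX2 : (X 2 : MvPolynomial (Fin 3) K) ∈ P)
    (hG : (1 + X 1 * X 1 + X 0 ^ 3 * X 1 * X 2 ^ 2 : MvPolynomial (Fin 3) K) ∈ P) :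
    pderiv 1 (1 + X 1 * X 1 + X 0 ^ 3 * X 1 * X 2 ^ 2 : MvPolynomial (Fin 3) K) ∉ P := by
  intro hd
  rw [map_add, map_add, pderiv_one, pderiv_mul, pderiv_X_self, pderiv_mul, pderiv_mul, pderiv_pow, pderiv_pow,
    pderiv_X_of_ne (by decide : (0 : Fin 3) ≠ 1), pderiv_X_self, pderiv_X_of_ne (by decide : (2 : Fin 3) ≠ 1)] at hd
  have hX1 : (X 1 : MvPolynomial (Fin 3) K) ∈ P := by
    refine mem_of_C_mul_mem K h2 P hP ?_
    rw [C_two_mul]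
    have e : (X 1 + X 1 : MvPolynomial (Fin 3) K) =
        (0 + (1 * X 1 + X 1 * 1) + ((↑3 * X 0 ^ (3 - 1) * 0 * X 1 + X 0 ^ 3 * 1) * X 2 ^ 2 + X 0 ^ 3 * X 1 * (↑2 * X 2 ^ (2 - 1) * 0))) -
          (X 0 ^ 3 * X 2) * X 2 := by ring
    rw [e]; exact P.sub_mem hd (P.mul_mem_left _ hX2)
  have e : (1 : MvPolynomial (Fin 3) K) = (1 + X 1 * X 1 + X 0 ^ 3 * X 1 * X 2 ^ 2) - (X 1 + X 0 ^ 3 * X 2 ^ 2) * X 1 := by ring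
  exact hP.ne_top ((Ideal.eq_top_iff_one P).mpr (e ▸ P.sub_mem hG (P.mul_mem_left _ hX1)))

/-! ## `E₆ = y₀³ + y₁⁴ + y₂²`: charts -/

/-- The tail `y₀³ + y₁⁴` lies in `(y)³`. [folklore] -/
theorem E₆_tail_mem_pow :
    (X 0 ^ 3 + X 1 ^ 4 : MvPolynomial (Fin 3) K) ∈ Ideal.span (Set.range (X : Fin 3 → MvPolynomial (Fin 3) K)) ^ (2 + 1) := by
  refine Ideal.add_mem _ ?_ ?_
  · simpa using monomial_mem_pow₃ K 3 0 0 (k := 2 + 1) (by norm_num)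
  · simpa using monomial_mem_pow₃ K 0 4 0 (k := 2 + 1) (by norm_num)

/-- **Chart `1` of `E₆`**: `E₆(T₁T₀, T₁, T₁T₂) = T₁²·(T₁·(T₀³ + T₁) + T₂²)` — the `A₅''` form `T₀³T₁ + T₁² + T₂²`. [cite: Hartshorne1977, II Ex. 7.12] -/
theorem E₆_strictTransform₁ :
    aeval (fun j => X 1 * Function.update (X : Fin 3 → MvPolynomial (Fin 3) K) 1 1 j)
        (X 2 ^ 2 + (X 0 ^ 3 + X 1 ^ 4) : MvPolynomial (Fin 3) K) = X 1 ^ 2 * (X 1 * (X 0 ^ 3 + X 1) + X 2 ^ 2) := by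
  simp only [map_add, map_pow, aeval_X, Function.update_self, Function.update_of_ne (by decide : (0 : Fin 3) ≠ 1),
    Function.update_of_ne (by decide : (2 : Fin 3) ≠ 1)]
  ring

/-- **Chart `0` of `E₆`**: `E₆(T₀, T₀T₁, T₀T₂) = T₀²·(T₀·(1 + T₀·T₁⁴) + T₂²)` — a graph chart. [cite: Hartshorne1977, II Ex. 7.12] -/
theorem E₆_strictTransform₀ :
    aeval (fun j => X 0 * Function.update (X : Fin 3 → MvPolynomial (Fin 3) K) 0 1 j)
        (X 2 ^ 2 + (X 0 ^ 3 + X 1 ^ 4) : MvPolynomial (Fin 3) K) = X 0 ^ 2 * (X 0 * (1 + X 0 * X 1 ^ 4) + X 2 ^ 2) := by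
  simp only [map_add, map_pow, aeval_X, Function.update_self, Function.update_of_ne (by decide : (1 : Fin 3) ≠ 0),
    Function.update_of_ne (by decide : (2 : Fin 3) ≠ 0)]
  ring

/-- **A graph chart is regular along `T_l = 0`**: `∂_l(T_l·(1 + T_l·B) + T₂²) ∉ P` for a prime `P ∋ T_l` (`l ≠ 2`). [cite: Hartshorne1977, I Thm. 5.1] -/
theorem pderiv_graph_not_mem' {l : Fin 3} (hl2 : (2 : Fin 3) ≠ l) (B : MvPolynomial (Fin 3) K) (P : Ideal (MvPolynomial (Fin 3) K)) (hP : P.IsPrime)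
    (hl : (X l : MvPolynomial (Fin 3) K) ∈ P) : pderiv l (X l * (1 + X l * B) + X 2 ^ 2 : MvPolynomial (Fin 3) K) ∉ P := by
  intro hd
  have h := mem_of_pderiv_linear' K hl2 (1 + X l * B) P hl hd
  have e : (1 : MvPolynomial (Fin 3) K) = (1 + X l * B) - X l * B := by ring
  exact hP.ne_top ((Ideal.eq_top_iff_one P).mpr (e ▸ P.sub_mem h (P.mul_mem_right _ hl)))

end SecondOrderPoint

namespace OneStep

variable (K : Type) [Field K]

/-- ★★ **`A₅'' = y₀³y₁ + y₁² + y₂²` HAS LEVEL `2` IN EVERY BLOW-UP TOWER** (`2 ≠ 0` in `K`): chart `0` carries `A₃'` (level `1`, ✓ `towerLevel_origin_A₃'`) at its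
origin, charts `1`, `2` are regular along the exceptional divisor. [OURS] [cite: Hartshorne1977, I Thm. 5.1, I Ex. 5.6] [cite: StacksProject, Tags 0804, 080E] -/
theorem towerLevel_origin_A₅'' (h2 : (2 : K) ≠ 0) (D : ℕ → ∀ Γ : Scheme.{0}, Γ → Prop)
    (hD0 : ∀ (Γ : Scheme.{0}) (y : Γ), IsClosed (({y} : Set Γ)) →
      (D 0 Γ y ↔ ∀ (hy : IsClosed (({y} : Set Γ))) (Z : Scheme.{0}) (τ : Z ⟶ Γ), IsBlowup τ (vanishingIdeal ⟨{y}, hy⟩) →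
        ∀ z : Z, τ z = y → IsRegularLocalRing (Z.presheaf.stalk z)))
    (hDsucc : ∀ (d : ℕ) (Γ : Scheme.{0}) (y : Γ), IsClosed (({y} : Set Γ)) →
      (D (d + 1) Γ y ↔ ∀ (hy : IsClosed (({y} : Set Γ))) (Z : Scheme.{0}) (τ : Z ⟶ Γ), IsBlowup τ (vanishingIdeal ⟨{y}, hy⟩) →
        ∃ S' : Finset Z, (∀ z : Z, τ z = y → z ∉ S' → IsRegularLocalRing (Z.presheaf.stalk z)) ∧
          ∀ z ∈ S', τ z = y ∧ IsClosed (({z} : Set Z)) ∧ ∃ d' ≤ d, D d' Z z)) :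
    ∀ (f : MvPolynomial (Fin 3) K), f = X 0 ^ 3 * X 1 + X 1 ^ 2 + X 2 ^ 2 →
      ∀ (y₀ : Spec (CommRingCat.of (MvPolynomial (Fin 3) K ⧸ Ideal.span {f}))),
        y₀.asIdeal = Ideal.map (Ideal.Quotient.mk (Ideal.span {f})) (Ideal.span (Set.range (X : Fin 3 → MvPolynomial (Fin 3) K))) →
        D 2 (Spec (CommRingCat.of (MvPolynomial (Fin 3) K ⧸ Ideal.span {f}))) y₀ := by
  classical
  intro f hf y₀ hy₀
  have e : ((X 1 ^ 2 + X 2 ^ 2) : MvPolynomial (Fin 3) K) + X 0 ^ 3 * X 1 = f := by rw [hf]; ring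
  subst e
  have hΦ : (X 1 ^ 2 + X 2 ^ 2 : MvPolynomial (Fin 3) K).IsHomogeneous 2 := (isHomogeneous_X_pow (1 : Fin 3) 2).add (isHomogeneous_X_pow (2 : Fin 3) 2)
  have hΦ0 : (X 1 ^ 2 + X 2 ^ 2 : MvPolynomial (Fin 3) K) ≠ 0 := by
    intro h
    have h1 := congrArg (eval (Pi.single (2 : Fin 3) (1 : K))) h
    simp at h1
  have hΨ : (X 0 ^ 3 * X 1 : MvPolynomial (Fin 3) K) ∈ Ideal.span (Set.range (X : Fin 3 → MvPolynomial (Fin 3) K)) ^ (2 + 1) := by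
    simpa using SecondOrderPoint.monomial_mem_pow₃ K 3 1 0 (k := 2 + 1) (by norm_num)
  have hΨ' : (X 0 ^ 2 * X 1 : MvPolynomial (Fin 3) K) ∈ Ideal.span (Set.range (X : Fin 3 → MvPolynomial (Fin 3) K)) ^ (2 + 1) := by
    simpa using SecondOrderPoint.monomial_mem_pow₃ K 2 1 0 (k := 2 + 1) (by norm_num)
  have hG₀ := SecondOrderPoint.A₅''_strictTransform₀ K
  have hG₁ := SecondOrderPoint.A₅''_strictTransform₁ K
  have hG₂ := SecondOrderPoint.A₅''_strictTransform₂ K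
  have htr₀ : aeval (fun i : Fin 3 => X i + C ((0 : Fin 3 → K) i)) (X 0 ^ 2 * X 1 + X 1 ^ 2 + X 2 ^ 2 : MvPolynomial (Fin 3) K) =
      (X 1 ^ 2 + X 2 ^ 2) + X 0 ^ 2 * X 1 := by
    rw [SecondOrderPoint.aeval_translate_zero]; ring
  refine towerLevel_succ_origin_marked K D hD0 hDsucc 1 (X 1 ^ 2 + X 2 ^ 2) (X 0 ^ 3 * X 1) (by norm_num) hΦ hΦ0 hΨ
    ![X 0 ^ 2 * X 1 + X 1 ^ 2 + X 2 ^ 2, 1 + X 2 * X 2 + X 0 ^ 3 * X 1 ^ 2, 1 + X 1 * X 1 + X 0 ^ 3 * X 1 * X 2 ^ 2] (fun a => ?_)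
    ![{(0 : Fin 3 → K)}, ∅, ∅] (fun a P hP haP hGP => ?_) (fun a lam hlam _ => ?_) y₀ hy₀
  · fin_cases a
    · exact hG₀
    · exact hG₁
    · exact hG₂
  · fin_cases a
    · by_cases hall : ∀ j, pderiv j (X 0 ^ 2 * X 1 + X 1 ^ 2 + X 2 ^ 2 : MvPolynomial (Fin 3) K) ∈ P
      · right
        refine ⟨0, ?_, ?_⟩
        · exact Finset.mem_singleton_self _
        · exact SecondOrderPoint.A₅''_jac₀ K h2 P hP haP hGP hall
      · left
        push Not at hall
        exact hall
    · exact Or.inl ⟨2, SecondOrderPoint.A₅''_chart₁_regular K h2 P hP haP hGP⟩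
    · exact Or.inl ⟨1, SecondOrderPoint.A₅''_chart₂_regular K h2 P hP haP hGP⟩
  · fin_cases a
    · have hlam0 : lam = 0 := by simpa using hlam
      subst hlam0
      exact ⟨2, X 1 ^ 2 + X 2 ^ 2, X 0 ^ 2 * X 1, by norm_num, hΦ, hΨ', htr₀,
        fun y' hy' => ⟨1, le_rfl, towerLevel_origin_A₃' K h2 D hD0 hDsucc _ (by ring) y' hy'⟩⟩
    · exact absurd hlam (Finset.notMem_empty _)
    · exact absurd hlam (Finset.notMem_empty _)

/-- ★★★ **`E₆ = y₀³ + y₁⁴ + y₂²` HAS LEVEL `3` IN EVERY BLOW-UP TOWER** (`2 ≠ 0` in `K`): chart `1` carries `A₅''` (level `2`) at its origin, the only singular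
point over the origin; chart `0` is a graph, chart `2` is empty. [OURS] [cite: Hartshorne1977, I Thm. 5.1, I Ex. 5.6] [cite: Lipman1969, §24]
[cite: StacksProject, Tag 080E] -/
theorem towerLevel_origin_E₆ (h2 : (2 : K) ≠ 0) (D : ℕ → ∀ Γ : Scheme.{0}, Γ → Prop)
    (hD0 : ∀ (Γ : Scheme.{0}) (y : Γ), IsClosed (({y} : Set Γ)) →
      (D 0 Γ y ↔ ∀ (hy : IsClosed (({y} : Set Γ))) (Z : Scheme.{0}) (τ : Z ⟶ Γ), IsBlowup τ (vanishingIdeal ⟨{y}, hy⟩) →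
        ∀ z : Z, τ z = y → IsRegularLocalRing (Z.presheaf.stalk z)))
    (hDsucc : ∀ (d : ℕ) (Γ : Scheme.{0}) (y : Γ), IsClosed (({y} : Set Γ)) →
      (D (d + 1) Γ y ↔ ∀ (hy : IsClosed (({y} : Set Γ))) (Z : Scheme.{0}) (τ : Z ⟶ Γ), IsBlowup τ (vanishingIdeal ⟨{y}, hy⟩) →
        ∃ S' : Finset Z, (∀ z : Z, τ z = y → z ∉ S' → IsRegularLocalRing (Z.presheaf.stalk z)) ∧
          ∀ z ∈ S', τ z = y ∧ IsClosed (({z} : Set Z)) ∧ ∃ d' ≤ d, D d' Z z)) :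
    ∀ (f : MvPolynomial (Fin 3) K), f = X 0 ^ 3 + X 1 ^ 4 + X 2 ^ 2 →
      ∀ (y₀ : Spec (CommRingCat.of (MvPolynomial (Fin 3) K ⧸ Ideal.span {f}))),
        y₀.asIdeal = Ideal.map (Ideal.Quotient.mk (Ideal.span {f})) (Ideal.span (Set.range (X : Fin 3 → MvPolynomial (Fin 3) K))) →
        D 3 (Spec (CommRingCat.of (MvPolynomial (Fin 3) K ⧸ Ideal.span {f}))) y₀ := by
  classical
  intro f hf y₀ hy₀
  have e : (X 2 ^ 2 : MvPolynomial (Fin 3) K) + (X 0 ^ 3 + X 1 ^ 4) = f := by rw [hf]; ring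
  subst e
  have hΦ : (X 2 ^ 2 : MvPolynomial (Fin 3) K).IsHomogeneous 2 := isHomogeneous_X_pow (2 : Fin 3) 2
  have hΦ0 : (X 2 ^ 2 : MvPolynomial (Fin 3) K) ≠ 0 := pow_ne_zero _ (X_ne_zero 2)
  have hΦ' : (X 1 ^ 2 + X 2 ^ 2 : MvPolynomial (Fin 3) K).IsHomogeneous 2 := (isHomogeneous_X_pow (1 : Fin 3) 2).add (isHomogeneous_X_pow (2 : Fin 3) 2)
  have hΨ := SecondOrderPoint.E₆_tail_mem_pow K
  have hΨ' : (X 0 ^ 3 * X 1 : MvPolynomial (Fin 3) K) ∈ Ideal.span (Set.range (X : Fin 3 → MvPolynomial (Fin 3) K)) ^ (2 + 1) := by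
    simpa using SecondOrderPoint.monomial_mem_pow₃ K 3 1 0 (k := 2 + 1) (by norm_num)
  obtain ⟨G₂, hG₂, hJ₂⟩ := SecondOrderPoint.sq_chart_vacuous₂ K hΨ
  have hG₀ := SecondOrderPoint.E₆_strictTransform₀ K
  have hG₁ := SecondOrderPoint.E₆_strictTransform₁ K
  have htr₁ : aeval (fun i : Fin 3 => X i + C ((0 : Fin 3 → K) i)) (X 1 * (X 0 ^ 3 + X 1) + X 2 ^ 2 : MvPolynomial (Fin 3) K) =
      (X 1 ^ 2 + X 2 ^ 2) + X 0 ^ 3 * X 1 := by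
    rw [SecondOrderPoint.aeval_translate_zero]; ring
  refine towerLevel_succ_origin_marked K D hD0 hDsucc 2 (X 2 ^ 2) (X 0 ^ 3 + X 1 ^ 4) (by norm_num) hΦ hΦ0 hΨ
    ![X 0 * (1 + X 0 * X 1 ^ 4) + X 2 ^ 2, X 1 * (X 0 ^ 3 + X 1) + X 2 ^ 2, G₂] (fun a => ?_)
    ![∅, {(0 : Fin 3 → K)}, ∅] (fun a P hP haP hGP => ?_) (fun a lam hlam _ => ?_) y₀ hy₀
  · fin_cases a
    · exact hG₀
    · exact hG₁
    · exact hG₂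
  · fin_cases a
    · exact Or.inl ⟨0, SecondOrderPoint.pderiv_graph_not_mem' K (l := 0) (by decide) _ P hP haP⟩
    · by_cases hall : ∀ j, pderiv j (X 1 * (X 0 ^ 3 + X 1) + X 2 ^ 2 : MvPolynomial (Fin 3) K) ∈ P
      · right
        have hX2 := SecondOrderPoint.X_two_mem_of_linear' K _ P hP haP hGP
        have hA := SecondOrderPoint.mem_of_pderiv_linear' K (l := 1) (by decide) _ P haP (hall 1)
        have hX0 : (X 0 : MvPolynomial (Fin 3) K) ∈ P := by
          refine hP.mem_of_pow_mem 3 ?_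
          have e : (X 0 ^ 3 : MvPolynomial (Fin 3) K) = (X 0 ^ 3 + X 1) - X 1 := by ring
          rw [e]; exact P.sub_mem hA haP
        refine ⟨0, ?_, ?_⟩
        · exact Finset.mem_singleton_self _
        · exact SecondOrderPoint.forall_X_sub_C_zero_mem K P hX0 haP hX2
      · left
        push Not at hall
        exact hall
    · exact (hJ₂ P hP haP hGP).elim
  · fin_cases a
    · exact absurd hlam (Finset.notMem_empty _)
    · have hlam0 : lam = 0 := by simpa using hlam
      subst hlam0
      exact ⟨2, X 1 ^ 2 + X 2 ^ 2, X 0 ^ 3 * X 1, by norm_num, hΦ', hΨ', htr₁,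
        fun y' hy' => ⟨2, le_rfl, towerLevel_origin_A₅'' K h2 D hD0 hDsucc _ (by ring) y' hy'⟩⟩
    · exact absurd hlam (Finset.notMem_empty _)

end OneStep

end Summit.ResolutionOfSingularities.ResolutionOfSingularities.Cruxes.EquisingularLiftNat.Sections

end
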